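import Summits.Ventures.CertifiedArithmetic.LowPrec.RoundNearestJRTransfer
import Summits.Ventures.CertifiedArithmetic.LowPrec.OptTreeWitness
import Summits.Ventures.CertifiedArithmetic.LowPrec.OptTreePairwise

/-!
# The tree-polynomial law in the bit-level formats (Theorem T4 for E4M3, E5M2, FP6/FP4, fp16, bf16, fp32)

HONEST FRAMING (venture CertifiedArithmetic / cell `pub-lowprec`): certified error envelopes and
provably optimal rounding/accumulation schemes for low-precision formats under stated cost models;
every table by two implementations; no hardware or vendor claims.

`LowPrec/OptTreePoly`, `OptTreeWitness`, `OptTreePairwise` (opt seat, OPTIMA.md Theorem T4) prove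
the TREE POLYNOMIAL LAW over the Jeannerod–Rump model `F(p, emin)` for an ABSTRACT nearest map
`fl` (`IsRoundNearest p emin fl`; sharpness under the tie hypothesis `TiesEvenAtPow`): for
nonnegative summands and every summation tree `t`, `exact ≤ M_t(u)·computed`, attained with
equality, and pairwise summation minimises `M_t` among all trees with `n` leaves.

With the rounding bridge (`RoundNearestJR`, `RoundNearestJRTransfer`: the format's saturating
RNE `flα α` IS such a nearest map on every in-range tree, and it rounds the binade midpoints to
even) the law becomes a theorem about the ACTUAL FORMATS of this venture, `u = u_α = 2^-(m+1)`:
* `exact_le_treeM_mul_eval_format` / `exact_sub_eval_le_format` (T4(a) in `α`): leaves values of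
  `α`, nonnegative, every node in range (`TreeInRange α`, the standing hypothesis of the R2 files)
  ⟹ `s - ŝ ≤ (1 - 1/M_t(u_α))·s` for EVERY evaluation tree;
* `tiesEvenAtPow_flJR`: the format rounding satisfies the opt seat's `TiesEvenAtPow`;
* `treePoly_attained_format` (T4(b) in `α`, `m ≥ 1`): for every tree `t` and scale `2^e` with
  `qexp + p·height t ≤ e` and `2^e(1+u) ≤ maxRat` the witness of `t` is GENUINE DATA OF `α`, every
  node of its evaluation is in range, it evaluates IN THE FORMAT to `2^e` while its exact sum is
  `2^e·M_t(u)`: the bound is attained, so the exact worst case of tree `t` in format `α` is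
  `1 - 1/M_t(u_α)` whenever the exponent range accommodates the witness;
* `pairwise_factor_le_witness_format` / `optimal_tree_bound_format`: consequently no tree on `n`
  leaves has a smaller worst case in `α` than pairwise summation's `1 - 1/B_n(u_α)` (opt's
  Theorem P, `optB`), which the `M`-optimal trees (pairwise, binary expansion) achieve;
* kernel replays: the E4M3 perfect 4-tree `((1+u)+(u+u²))` computes `1` for the exact `(1+u)²`
  (under-estimation `33/289 = 1 - (1+u)^-2`), bfloat16 likewise `1 - (257/256)^-2`.
-/

namespace Summit.Ventures.CertifiedArithmetic.LowPrec.Opt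

open Literature.ComputerArithmetic.JeannerodRump2018
open Literature.ComputerArithmetic.JeannerodRump2018.SumTree
open Literature.ComputerArithmetic.FloatingPoint
open Literature.ComputerArithmetic.FloatingPoint.MiniFloat

/-! ## The format's unit roundoff and the tie hypothesis -/

/-- The model's `u = 1/2^p` at `p = m+1` is the format's unit roundoff `2^-(m+1)`. -/
theorem unitRoundoff_succ_manBits (α : Format) : unitRoundoff (α.manBits + 1) = α.unitRoundoff := by
  rw [Format.unitRoundoff_eq]; rfl

/-- `0 ≤ u_α`. -/
theorem format_unitRoundoff_nonneg (α : Format) : 0 ≤ α.unitRoundoff := α.unitRoundoff_pos.le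

/-- `u_α ≤ 1`. -/
theorem format_unitRoundoff_le_one (α : Format) : α.unitRoundoff ≤ 1 := by
  rw [← unitRoundoff_succ_manBits]; exact unitRoundoff_le_one _

/-- THE FORMAT ROUNDING ROUNDS BINADE MIDPOINTS TO EVEN: `flJR α` (= `roundNE α` in range)
satisfies the opt seat's `TiesEvenAtPow (m+1) (qexp α)` for every format with `m ≥ 1`. -/
theorem tiesEvenAtPow_flJR (α : Format) (hm : 1 ≤ α.manBits) :
    TiesEvenAtPow (α.manBits + 1) α.qexp α.flJR := by
  intro e he
  exact Format.flJR_midpoint_pow hm he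

/-! ## T4(a) in the formats: the under-estimation bound for every tree -/

/-- **THEOREM U IN FORMAT `α`**: for an evaluation tree whose leaves are values of `α`, all
nonnegative, and whose every node stays in range, the format's computed sum satisfies
`exact ≤ M_t(u_α) · computed` — every minifloat / IEEE format, gradual underflow included. -/
theorem exact_le_treeM_mul_eval_format (α : Format) (t : SumTree) (ht : TreeInRange α t)
    (hpos : ∀ x ∈ leaves t, 0 ≤ x) :
    exact t ≤ treeM α.unitRoundoff t * eval (flα α) t := by
  rw [eval_flα_eq_eval_flJR t ht, ← unitRoundoff_succ_manBits]
  exact exact_le_treeM_mul_eval_roundNearest (by omega) (Format.isRoundNearest_flJR α) t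
    (fun x hx => ⟨isFloat_of_mem_leaves t ht x hx, hpos x hx⟩)

/-- Relative form of Theorem U in format `α`: `exact - computed ≤ (1 - 1/M_t(u_α)) · exact`. -/
theorem exact_sub_eval_le_format (α : Format) (t : SumTree) (ht : TreeInRange α t)
    (hpos : ∀ x ∈ leaves t, 0 ≤ x) :
    exact t - eval (flα α) t ≤ (1 - 1 / treeM α.unitRoundoff t) * exact t := by
  rw [eval_flα_eq_eval_flJR t ht, ← unitRoundoff_succ_manBits]
  exact exact_sub_eval_le_roundNearest (by omega) (Format.isRoundNearest_flJR α) t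
    (fun x hx => ⟨isFloat_of_mem_leaves t ht x hx, hpos x hx⟩)

/-! ## T4(b) in the formats: the witness is format data and attains the bound -/

section Witness

variable {α : Format}

/-- The scales of the witness: `2^e · u^j = 2^(e - p j)`, a power of two. -/
theorem scale_eq_zpow (α : Format) (e : ℤ) (j : ℕ) :
    (2 : ℚ) ^ e * α.unitRoundoff ^ j = (2 : ℚ) ^ (e - (((α.manBits + 1) * j : ℕ) : ℤ)) := by
  rw [← unitRoundoff_succ_manBits]; exact two_zpow_mul_u_pow _ e j

/-- A power of two between the quantum and `maxRat` is a value of `α`. -/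
theorem exists_toRat_eq_two_zpow {E : ℤ} (hE : α.qexp ≤ E) (hle : (2 : ℚ) ^ E ≤ α.maxRat) :
    ∃ y : MiniFloat α, y.toRat = (2 : ℚ) ^ E := by
  have hF : IsFloat (α.manBits + 1) α.qexp ((2 : ℚ) ^ E) := by
    refine ⟨1, E, ?_, hE, by simp⟩
    have : (1 : ℤ) < 2 ^ (α.manBits + 1) := one_lt_pow₀ (by norm_num) (by omega)
    simpa using this
  exact exists_toRat_eq_of_isFloat hF (by rwa [abs_of_pos (zpow_pos (by norm_num : (0:ℚ) < 2) E)])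

/-- Hypotheses of the witness at scale `2^e` with `N` levels: every scale `2^e u^j`, `j ≤ N`, is a
value of `α`; every midpoint `2^e u^j (1+u)`, `j < N`, is in range and the FORMAT rounds it to
`2^e u^j`. -/
theorem witness_hyps (hm : 1 ≤ α.manBits) {N : ℕ} {e : ℤ}
    (he : α.qexp + (((α.manBits + 1) * N : ℕ) : ℤ) ≤ e)
    (hrange : (2 : ℚ) ^ e * (1 + α.unitRoundoff) ≤ α.maxRat) :
    (∀ j : ℕ, j ≤ N → ∃ y : MiniFloat α, y.toRat = (2 : ℚ) ^ e * α.unitRoundoff ^ j) ∧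
    (∀ j : ℕ, j < N →
      |(2 : ℚ) ^ e * α.unitRoundoff ^ j + (2 : ℚ) ^ e * α.unitRoundoff ^ (j + 1)| ≤ α.maxRat) ∧
    (∀ j : ℕ, j < N →
      flα α ((2 : ℚ) ^ e * α.unitRoundoff ^ j + (2 : ℚ) ^ e * α.unitRoundoff ^ (j + 1))
        = (2 : ℚ) ^ e * α.unitRoundoff ^ j) := by
  have hu0 := format_unitRoundoff_nonneg α
  have hu1 := format_unitRoundoff_le_one α
  have h2e : (0 : ℚ) < (2 : ℚ) ^ e := zpow_pos (by norm_num) e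
  -- exponent bookkeeping: `qexp ≤ e - p j` for `j ≤ N`
  have hexp : ∀ j : ℕ, j ≤ N → α.qexp ≤ e - (((α.manBits + 1) * j : ℕ) : ℤ) := by
    intro j hj
    have : (α.manBits + 1) * j ≤ (α.manBits + 1) * N := Nat.mul_le_mul_left _ hj
    have : (((α.manBits + 1) * j : ℕ) : ℤ) ≤ (((α.manBits + 1) * N : ℕ) : ℤ) := by exact_mod_cast this
    omega
  -- every scale is at most `2^e`, every midpoint at most `2^e (1+u) ≤ maxRat`
  have hpow_le : ∀ j : ℕ, (2 : ℚ) ^ e * α.unitRoundoff ^ j ≤ (2 : ℚ) ^ e := fun j =>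
    mul_le_of_le_one_right h2e.le (pow_le_one₀ hu0 hu1)
  have hmid : ∀ j : ℕ, (2 : ℚ) ^ e * α.unitRoundoff ^ j + (2 : ℚ) ^ e * α.unitRoundoff ^ (j + 1)
      = (2 : ℚ) ^ e * α.unitRoundoff ^ j * (1 + α.unitRoundoff) := fun j => by ring
  have hmid_le : ∀ j : ℕ,
      |(2 : ℚ) ^ e * α.unitRoundoff ^ j + (2 : ℚ) ^ e * α.unitRoundoff ^ (j + 1)| ≤ α.maxRat := by
    intro j
    rw [hmid, abs_of_nonneg (by positivity)]
    calc (2 : ℚ) ^ e * α.unitRoundoff ^ j * (1 + α.unitRoundoff)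
        ≤ (2 : ℚ) ^ e * (1 + α.unitRoundoff) :=
          mul_le_mul_of_nonneg_right (hpow_le j) (by linarith)
      _ ≤ α.maxRat := hrange
  refine ⟨fun j hj => ?_, fun j _ => hmid_le j, fun j hj => ?_⟩
  · rw [scale_eq_zpow]
    refine exists_toRat_eq_two_zpow (hexp j hj) ?_
    rw [← scale_eq_zpow]; exact le_trans (hpow_le j) (le_trans (by nlinarith [hpow_le 0]) hrange)
  · rw [flα_eq_flJR (hmid_le j)]
    have hj' := hexp j hj.le
    rw [pow_succ, ← mul_assoc, scale_eq_zpow, Format.unitRoundoff_eq]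
    exact Format.flJR_midpoint_pow hm hj'

/-- Every node of the witness stays in range (so the witness is a legitimate in-range evaluation
of format data, to which Theorem U applies). -/
theorem treeInRange_wit {u s : ℚ} {N : ℕ}
    (hleaf : ∀ j : ℕ, j ≤ N → ∃ y : MiniFloat α, y.toRat = s * u ^ j)
    (hnode : ∀ j : ℕ, j < N → |s * u ^ j + s * u ^ (j + 1)| ≤ α.maxRat)
    (hT : ∀ j : ℕ, j < N → flα α (s * u ^ j + s * u ^ (j + 1)) = s * u ^ j) :
    ∀ (t : SumTree) (k : ℕ), k + height t ≤ N → TreeInRange α (wit u s t k)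
  | .leaf x, k, hk => by
      simp only [wit, TreeInRange]
      exact hleaf k (by simpa using hk)
  | .node a b, k, hk => by
      have hma := le_max_left (height a) (height b)
      have hmb := le_max_right (height a) (height b)
      simp only [height_node] at hk
      have ha : k + 1 + height a ≤ N := by omega
      have hb : k + 1 + height b ≤ N := by omega
      have ha0 : k + height a ≤ N := by omega
      have hb0 : k + height b ≤ N := by omega
      have hkN : k < N := by omega
      by_cases h : treeM u b ≤ treeM u a
      · simp only [wit, if_pos h, TreeInRange]
        refine ⟨treeInRange_wit hleaf hnode hT a k ha0, treeInRange_wit hleaf hnode hT b (k + 1) hb, ?_⟩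
        rw [eval_wit u s hT a k ha0, eval_wit u s hT b (k + 1) hb]
        exact hnode k hkN
      · simp only [wit, if_neg h, TreeInRange]
        refine ⟨treeInRange_wit hleaf hnode hT a (k + 1) ha, treeInRange_wit hleaf hnode hT b k hb0, ?_⟩
        rw [eval_wit u s hT a (k + 1) ha, eval_wit u s hT b k hb0, add_comm]
        exact hnode k hkN

/-- **THE BOUND OF THEOREM U IS ATTAINED IN FORMAT `α`** (`m ≥ 1`): for every tree `t` and every
scale `2^e` with `qexp α + p·height t ≤ e` and `2^e (1 + u) ≤ maxRat α`, the witness of `t` at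
scale `2^e` is a tree of nonnegative VALUES OF `α` with every node in range and the same tree
polynomial as `t`; evaluated IN THE FORMAT (saturating RNE, `flα α`) it gives `2^e`, its exact sum
is `2^e · M_t(u_α)`, so it under-estimates by EXACTLY `(1 - 1/M_t(u_α)) · exact`. -/
theorem treePoly_attained_format (hm : 1 ≤ α.manBits) (t : SumTree) {e : ℤ}
    (he : α.qexp + (((α.manBits + 1) * height t : ℕ) : ℤ) ≤ e)
    (hrange : (2 : ℚ) ^ e * (1 + α.unitRoundoff) ≤ α.maxRat) :
    TreeInRange α (wit α.unitRoundoff ((2 : ℚ) ^ e) t 0) ∧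
    (∀ x ∈ leaves (wit α.unitRoundoff ((2 : ℚ) ^ e) t 0), 0 ≤ x) ∧
    treeM α.unitRoundoff (wit α.unitRoundoff ((2 : ℚ) ^ e) t 0) = treeM α.unitRoundoff t ∧
    eval (flα α) (wit α.unitRoundoff ((2 : ℚ) ^ e) t 0) = (2 : ℚ) ^ e ∧
    exact (wit α.unitRoundoff ((2 : ℚ) ^ e) t 0) = (2 : ℚ) ^ e * treeM α.unitRoundoff t ∧
    exact (wit α.unitRoundoff ((2 : ℚ) ^ e) t 0) - eval (flα α) (wit α.unitRoundoff ((2 : ℚ) ^ e) t 0)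
      = (1 - 1 / treeM α.unitRoundoff t) * exact (wit α.unitRoundoff ((2 : ℚ) ^ e) t 0) := by
  obtain ⟨hleaf, hnode, hT⟩ := witness_hyps hm he hrange
  have hu0 := format_unitRoundoff_nonneg α
  refine ⟨treeInRange_wit hleaf hnode hT t 0 (by simp), ?_, treeM_wit _ _ t 0,
    by rw [eval_wit _ _ hT t 0 (by simp), pow_zero, mul_one], by rw [exact_wit]; ring,
    witness_attains _ _ hu0 hT t le_rfl⟩
  intro x hx
  obtain ⟨j, -, -, rfl⟩ := mem_leaves_wit _ _ t 0 x hx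
  positivity

end Witness

/-! ## Pairwise summation is worst-case optimal in every format -/

/-- The witness has as many leaves as the tree. -/
theorem length_leaves_wit (u s : ℚ) : ∀ (t : SumTree) (k : ℕ),
    (leaves (wit u s t k)).length = (leaves t).length
  | .leaf x, k => by simp [wit, leaves]
  | .node a b, k => by
      by_cases h : treeM u b ≤ treeM u a
      · simp only [wit, if_pos h, leaves, List.length_append, length_leaves_wit u s a,
          length_leaves_wit u s b]
      · simp only [wit, if_neg h, leaves, List.length_append, length_leaves_wit u s a,
          length_leaves_wit u s b]

/-- `1 ≤ B_n(u)` for `n ≥ 1`, `u ≥ 0`. -/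
theorem one_le_optB {u : ℚ} (hu : 0 ≤ u) {n : ℕ} (hn : 1 ≤ n) : 1 ≤ optB u n := by
  simpa using optB_mono hu hn

/-- **LOWER BOUND FOR EVERY TREE IN FORMAT `α`** (`m ≥ 1`): for every tree `t` on `n` leaves whose
witness fits (`qexp + p·height t ≤ e`, `2^e(1+u) ≤ maxRat`) there is in-range, nonnegative data of
`α` of the same shape (same number of leaves, same tree polynomial) with positive sum on which the
format under-estimates by AT LEAST the pairwise factor `1 - 1/B_n(u_α)` (indeed by exactly
`1 - 1/M_t(u_α) ≥ 1 - 1/B_n(u_α)`, Theorem P). -/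
theorem pairwise_factor_le_witness_format {α : Format} (hm : 1 ≤ α.manBits) (t : SumTree) {e : ℤ}
    (he : α.qexp + (((α.manBits + 1) * height t : ℕ) : ℤ) ≤ e)
    (hrange : (2 : ℚ) ^ e * (1 + α.unitRoundoff) ≤ α.maxRat) :
    ∃ w : SumTree, (leaves w).length = (leaves t).length ∧
      treeM α.unitRoundoff w = treeM α.unitRoundoff t ∧ TreeInRange α w ∧
      (∀ x ∈ leaves w, 0 ≤ x) ∧ 0 < exact w ∧
      (1 - 1 / optB α.unitRoundoff (leaves t).length) * exact w ≤ exact w - eval (flα α) w := by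
  have hu0 := format_unitRoundoff_nonneg α
  have hu1 := format_unitRoundoff_le_one α
  obtain ⟨hin, hpos, hM, -, hexact, hatt⟩ := treePoly_attained_format hm t he hrange
  have hMt : 1 ≤ treeM α.unitRoundoff t := one_le_treeM hu0 t
  have hexpos : 0 < exact (wit α.unitRoundoff ((2 : ℚ) ^ e) t 0) := by
    rw [hexact]; exact mul_pos (zpow_pos (by norm_num) e) (by linarith)
  refine ⟨_, length_leaves_wit _ _ t 0, hM, hin, hpos, hexpos, ?_⟩
  rw [hatt]
  have hB1 : 1 ≤ optB α.unitRoundoff (leaves t).length :=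
    one_le_optB hu0 (one_le_length_leaves t)
  have hBM : optB α.unitRoundoff (leaves t).length ≤ treeM α.unitRoundoff t := optB_le_treeM hu0 hu1 t
  have hinv : 1 / treeM α.unitRoundoff t ≤ 1 / optB α.unitRoundoff (leaves t).length :=
    one_div_le_one_div_of_le (by linarith) hBM
  exact mul_le_mul_of_nonneg_right (by linarith) hexpos.le

/-- **UPPER BOUND FOR THE OPTIMAL TREES IN FORMAT `α`**: a tree whose polynomial is minimal for its
number of leaves (`M_t(u_α) ≤ B_n(u_α)`; the pairwise tree `pw n` and the binary-expansion tree are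
such, `treeM_pw`) under-estimates every in-range nonnegative input by at most `1 - 1/B_n(u_α)`. -/
theorem optimal_tree_bound_format (α : Format) (s : SumTree) (hs : TreeInRange α s)
    (hpos : ∀ x ∈ leaves s, 0 ≤ x)
    (hopt : treeM α.unitRoundoff s ≤ optB α.unitRoundoff (leaves s).length) :
    exact s - eval (flα α) s ≤ (1 - 1 / optB α.unitRoundoff (leaves s).length) * exact s := by
  have hu0 := format_unitRoundoff_nonneg α
  have hu1 := format_unitRoundoff_le_one α
  have heq : treeM α.unitRoundoff s = optB α.unitRoundoff (leaves s).length :=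
    le_antisymm hopt (optB_le_treeM hu0 hu1 s)
  rw [← heq]
  exact exact_sub_eval_le_format α s hs hpos

/-! ## Kernel replays (the certified C13 cells, now computed by the format itself) -/

/-- E4M3 (`u = 1/16`), perfect tree on 4 leaves `((1 + u) + (u + u²))`: the format computes `1`
(both inner additions are ties to even, the outer one too) while the exact sum is
`(1+u)² = 289/256`: relative under-estimation `33/289 = 1 - 1/M_t(u)`, `M_t = (1+u)²` — the
certified C13 value, and it beats every height-2 guess `2u/(1+2u) = 2/18`. -/
theorem e4m3_perfect4_witness :
    eval (flα Format.E4M3)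
        (.node (.node (.leaf 1) (.leaf (1 / 16))) (.node (.leaf (1 / 16)) (.leaf (1 / 256)))) = 1 ∧
      exact (.node (.node (.leaf 1) (.leaf (1 / 16))) (.node (.leaf (1 / 16)) (.leaf (1 / 256))))
        = 289 / 256 := by
  constructor
  · decide +kernel
  · simp [exact]; norm_num

/-- The same tree IS the opt seat's witness `wit u 1 t 0` of the perfect 4-tree at scale `2^0`
in E4M3, and Theorem `treePoly_attained_format` applies to it (`qexp = -9 ≤ 0 - 4·2`,
`(1+u) ≤ 448`): a concrete instance of the general attainment theorem. -/
example : wit Format.E4M3.unitRoundoff ((2 : ℚ) ^ (0 : ℤ))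
      (.node (.node (.leaf 0) (.leaf 0)) (.node (.leaf 0) (.leaf 0))) 0
    = .node (.node (.leaf 1) (.leaf (1 / 16))) (.node (.leaf (1 / 16)) (.leaf (1 / 256))) := by
  have hu : Format.E4M3.unitRoundoff = 1 / 16 := by rw [Format.unitRoundoff_eq]; rfl
  simp [wit, treeM, hu]
  norm_num

/-- bfloat16 (`u = 2^-8`): the perfect 4-tree witness `(1, u, u, u²)` computes `1` for the exact
`(1 + u)² = 66049/65536` (under-estimation `513/66049 = 1 - (256/257)²`). -/
theorem bf16_perfect4_witness :
    eval (flα Format.BFloat16)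
        (.node (.node (.leaf 1) (.leaf (1 / 256))) (.node (.leaf (1 / 256)) (.leaf (1 / 65536)))) = 1 ∧
      exact (.node (.node (.leaf 1) (.leaf (1 / 256))) (.node (.leaf (1 / 256)) (.leaf (1 / 65536))))
        = 66049 / 65536 := by
  constructor
  · decide +kernel
  · simp [exact]; norm_num

/-! ## Statement-style R4 proposition -/

/-- R4 (Opt, CM-T in the formats): THE TREE POLYNOMIAL LAW HOLDS IN EVERY BIT-LEVEL FORMAT.  For
every format `α` with `m ≥ 1` (E4M3, E5M2, E3M2, E2M3, E2M1, binary16, bfloat16, binary32, the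
P3109 formats, …) and its saturating round-to-nearest-even arithmetic: (i) every evaluation tree
of nonnegative data of `α` with nodes in range under-estimates by at most `1 - 1/M_t(u_α)`;
(ii) for every tree whose witness fits the exponent range this is attained by data of `α`;
hence the exact worst case of tree `t` in `α` is `1 - 1/M_t(u_α)` and (Theorem P) pairwise
summation is worst-case optimal among all trees on `n` summands. -/
def R4_TreePolyFormats : Prop :=
  ∀ α : Format, 1 ≤ α.manBits →
    (∀ t : SumTree, TreeInRange α t → (∀ x ∈ leaves t, 0 ≤ x) →
      exact t - eval (flα α) t ≤ (1 - 1 / treeM α.unitRoundoff t) * exact t) ∧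
    (∀ (t : SumTree) (e : ℤ), α.qexp + (((α.manBits + 1) * height t : ℕ) : ℤ) ≤ e →
      (2 : ℚ) ^ e * (1 + α.unitRoundoff) ≤ α.maxRat →
      ∃ w : SumTree, treeM α.unitRoundoff w = treeM α.unitRoundoff t ∧ TreeInRange α w ∧
        (∀ x ∈ leaves w, 0 ≤ x) ∧ 0 < exact w ∧
        exact w - eval (flα α) w = (1 - 1 / treeM α.unitRoundoff t) * exact w)

/-- `R4_TreePolyFormats` holds. -/
theorem R4_TreePolyFormats_holds : R4_TreePolyFormats := by
  intro α hm
  refine ⟨fun t ht hpos => exact_sub_eval_le_format α t ht hpos, fun t e he hrange => ?_⟩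
  obtain ⟨hin, hpos, hM, -, hexact, hatt⟩ := treePoly_attained_format hm t he hrange
  have hMt : 1 ≤ treeM α.unitRoundoff t := one_le_treeM (format_unitRoundoff_nonneg α) t
  exact ⟨_, hM, hin, hpos, by rw [hexact]; exact mul_pos (zpow_pos (by norm_num) e) (by linarith), hatt⟩

end Summit.Ventures.CertifiedArithmetic.LowPrec.Opt
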